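import Summits.Parity.GeneralizedHardyLittlewood.Theorems.GreenTaoLevelTwoGITwoCyclicInverseBohrRegularPrelims
import Mathlib.Analysis.Complex.Basic

/-!
# Route `GreenTaoLevelTwo`, crux `GITwo` (stmt-Parity-21275), line `birth`, stub `stub_cyclicInverse`:
# smoothing the indicator of a regular Bohr set (GT08a arXiv §12, proof of Thm. 68)

Sixty-fourth helper file toward the XL stub `stub_cyclicInverse` (B. Green, T. Tao, *An inverse
theorem for the Gowers `U³(G)` norm*, arXiv:math/0503014, Thm. 68 = PEMS 51 (2008) Thm. 12.8).
Block E17 (arXiv §12, proof of Thm. 68): "Consider the function `∏_{ξ∈S} χ^{1+4d}(ξ·n) − 1_B(n)`.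
It is supported on `B(S,ρ(1+ε)) ∖ B(S,ρ(1−ε))`, which by the regularity of `B` has cardinality no
more than `200dε|B|`. Thus … `|𝔼_n T^h f(n) e(−φ(n)) ∏_{ξ∈S} χ^{1+4d}(ξ·n)| ≥ (η^C − 200dε) 𝔼1_B`."
Def-free, in the Bohr-set vocabulary of the sibling files (`S : Finset (ℤ/Nℤ)`, strict Bohr sets,
regularity in the two-sided counting form of `exists_regular_bohr`):

* `card_shell_le_of_regular` — `#(B(S,(1+ε)ρ)) − #(B(S,(1−ε)ρ)) ≤ 200 d ε #B(S,ρ)`;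
* `norm_sum_bohr_sub_sum_weight_le` — for a weight `P : ℤ/Nℤ → [0,1]` with `P = 1` on
  `B(S,(1−ε)ρ)` and `P = 0` off `B(S,(1+ε)ρ)` and `‖g‖ ≤ 1`:
  `‖∑_{x∈B(S,ρ)} g x − ∑_x P x · g x‖ ≤ 200 d ε #B(S,ρ)`;
* `prod_cutoff_eq_one`, `prod_cutoff_eq_zero`, `prod_cutoff_mem_Icc` — the product weight
  `P(x) = ∏_{ξ∈S} κ(xξ/N)` built from a circle cutoff `κ` (`…CircleCutoff`) has these properties.

References: [GreenTao2008U3Inverse] arXiv:math/0503014, §12, proof of Thm. 68.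
-/

noncomputable section

namespace Summit.Parity.GeneralizedHardyLittlewood.GreenTaoLevelTwoGITwoCyclicInverse

open Finset

variable {N : ℕ} [NeZero N]

/-- **The shell of a regular Bohr set is small**: `#B(S,(1+ε)ρ) − #B(S,(1−ε)ρ) ≤ 200 d ε · #B(S,ρ)`
for `0 < ε ≤ 1/(100d)` and `B(S,ρ)` regular. [cite: GreenTao2008U3Inverse, §12, proof of Thm. 68] -/
theorem card_shell_le_of_regular (S : Finset (ZMod N)) {ρ ε : ℝ} (hε0 : 0 < ε)
    (hε100 : ε ≤ 1 / (100 * (#S : ℝ)))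
    (hreg : ∀ r : ℝ, |r| ≤ 1 / (100 * (#S : ℝ)) →
      (1 - 100 * (#S : ℝ) * |r|) * #{x : ZMod N | ∀ ξ ∈ S, ‖ZMod.toAddCircle (x * ξ)‖ < ρ} ≤
          #{x : ZMod N | ∀ ξ ∈ S, ‖ZMod.toAddCircle (x * ξ)‖ < (1 + r) * ρ} ∧
        (#{x : ZMod N | ∀ ξ ∈ S, ‖ZMod.toAddCircle (x * ξ)‖ < (1 + r) * ρ} : ℝ) ≤
          (1 + 100 * (#S : ℝ) * |r|) * #{x : ZMod N | ∀ ξ ∈ S, ‖ZMod.toAddCircle (x * ξ)‖ < ρ}) :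
    (#{x : ZMod N | ∀ ξ ∈ S, ‖ZMod.toAddCircle (x * ξ)‖ < (1 + ε) * ρ} : ℝ) -
        #{x : ZMod N | ∀ ξ ∈ S, ‖ZMod.toAddCircle (x * ξ)‖ < (1 - ε) * ρ} ≤
      200 * (#S : ℝ) * ε * #{x : ZMod N | ∀ ξ ∈ S, ‖ZMod.toAddCircle (x * ξ)‖ < ρ} := by
  have hregp := (hreg ε (by rw [abs_of_pos hε0]; exact hε100)).2
  have hregm := (hreg (-ε) (by rw [abs_neg, abs_of_pos hε0]; exact hε100)).1
  rw [abs_of_pos hε0] at hregp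
  rw [abs_neg, abs_of_pos hε0, ← sub_eq_add_neg] at hregm
  linarith

/-- **Smoothing the indicator of a regular Bohr set** (proof of arXiv Thm. 68): if
`P : ℤ/Nℤ → [0,1]` equals `1` on `B(S,(1−ε)ρ)` and `0` outside `B(S,(1+ε)ρ)`, then for every `g`
with `‖g‖ ≤ 1`, `‖∑_{x∈B(S,ρ)} g x − ∑_x P x · g x‖ ≤ 200 d ε · #B(S,ρ)`.
[cite: GreenTao2008U3Inverse, §12, proof of Thm. 68] -/
theorem norm_sum_bohr_sub_sum_weight_le (S : Finset (ZMod N)) {ρ ε : ℝ} (hρ : 0 < ρ)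
    (hε0 : 0 < ε) (hε100 : ε ≤ 1 / (100 * (#S : ℝ)))
    (hreg : ∀ r : ℝ, |r| ≤ 1 / (100 * (#S : ℝ)) →
      (1 - 100 * (#S : ℝ) * |r|) * #{x : ZMod N | ∀ ξ ∈ S, ‖ZMod.toAddCircle (x * ξ)‖ < ρ} ≤
          #{x : ZMod N | ∀ ξ ∈ S, ‖ZMod.toAddCircle (x * ξ)‖ < (1 + r) * ρ} ∧
        (#{x : ZMod N | ∀ ξ ∈ S, ‖ZMod.toAddCircle (x * ξ)‖ < (1 + r) * ρ} : ℝ) ≤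
          (1 + 100 * (#S : ℝ) * |r|) * #{x : ZMod N | ∀ ξ ∈ S, ‖ZMod.toAddCircle (x * ξ)‖ < ρ})
    (P : ZMod N → ℝ) (hP : ∀ x, 0 ≤ P x ∧ P x ≤ 1)
    (hP1 : ∀ x, (∀ ξ ∈ S, ‖ZMod.toAddCircle (x * ξ)‖ < (1 - ε) * ρ) → P x = 1)
    (hP0 : ∀ x, (∃ ξ ∈ S, (1 + ε) * ρ ≤ ‖ZMod.toAddCircle (x * ξ)‖) → P x = 0)
    (g : ZMod N → ℂ) (hg : ∀ x, ‖g x‖ ≤ 1) :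
    ‖∑ x ∈ ({x : ZMod N | ∀ ξ ∈ S, ‖ZMod.toAddCircle (x * ξ)‖ < ρ} : Finset (ZMod N)), g x -
        ∑ x : ZMod N, (P x : ℂ) * g x‖ ≤
      200 * (#S : ℝ) * ε * #{x : ZMod N | ∀ ξ ∈ S, ‖ZMod.toAddCircle (x * ξ)‖ < ρ} := by
  classical
  set B : Finset (ZMod N) := {x : ZMod N | ∀ ξ ∈ S, ‖ZMod.toAddCircle (x * ξ)‖ < ρ} with hB
  set Bp : Finset (ZMod N) := {x : ZMod N | ∀ ξ ∈ S, ‖ZMod.toAddCircle (x * ξ)‖ < (1 + ε) * ρ}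
    with hBp
  set Bm : Finset (ZMod N) := {x : ZMod N | ∀ ξ ∈ S, ‖ZMod.toAddCircle (x * ξ)‖ < (1 - ε) * ρ}
    with hBm
  have hmemB : ∀ x, x ∈ B ↔ ∀ ξ ∈ S, ‖ZMod.toAddCircle (x * ξ)‖ < ρ := fun x => by
    rw [hB, mem_filter]; simp
  have hmemBp : ∀ x, x ∈ Bp ↔ ∀ ξ ∈ S, ‖ZMod.toAddCircle (x * ξ)‖ < (1 + ε) * ρ := fun x => by
    rw [hBp, mem_filter]; simp
  have hmemBm : ∀ x, x ∈ Bm ↔ ∀ ξ ∈ S, ‖ZMod.toAddCircle (x * ξ)‖ < (1 - ε) * ρ := fun x => by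
    rw [hBm, mem_filter]; simp
  have hshell := card_shell_le_of_regular S hε0 hε100 hreg
  have hr1 : (1 - ε) * ρ ≤ ρ := by nlinarith
  have hr2 : ρ ≤ (1 + ε) * ρ := by nlinarith
  -- write the Bohr sum as a sum over everything with the indicator
  have hsumB : ∑ x ∈ B, g x = ∑ x : ZMod N, (if x ∈ B then g x else 0) := by
    rw [← Finset.sum_filter]; congr 1; ext x; simp
  rw [hsumB, ← Finset.sum_sub_distrib]
  -- termwise: the difference vanishes off the shell `Bp \ Bm` and is `≤ 1` on it
  have hterm : ∀ x : ZMod N, ‖(if x ∈ B then g x else 0) - (P x : ℂ) * g x‖ ≤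
      (if x ∈ Bp then (1 : ℝ) else 0) - (if x ∈ Bm then (1 : ℝ) else 0) := by
    intro x
    have hBmB : x ∈ Bm → x ∈ B := fun h => (hmemB x).2 fun ξ hξ =>
      ((hmemBm x).1 h ξ hξ).trans_le hr1
    have hBBp : x ∈ B → x ∈ Bp := fun h => (hmemBp x).2 fun ξ hξ =>
      ((hmemB x).1 h ξ hξ).trans_le hr2
    by_cases hm : x ∈ Bm
    · -- inner: indicator `1`, `P = 1`
      have hb : x ∈ B := hBmB hm
      rw [if_pos hb, if_pos (hBBp hb), if_pos hm, hP1 x ((hmemBm x).1 hm)]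
      simp
    · by_cases hp : x ∈ Bp
      · -- shell: bound by `1`
        rw [if_pos hp, if_neg hm, sub_zero]
        by_cases hb : x ∈ B
        · rw [if_pos hb]
          have e : g x - (P x : ℂ) * g x = ((1 - P x : ℝ) : ℂ) * g x := by push_cast; ring
          rw [e, norm_mul, Complex.norm_real, Real.norm_eq_abs,
            abs_of_nonneg (by linarith [(hP x).2])]
          calc (1 - P x) * ‖g x‖ ≤ 1 * 1 :=
                mul_le_mul (by linarith [(hP x).1]) (hg x) (norm_nonneg _) zero_le_one
            _ = 1 := one_mul 1
        · rw [if_neg hb, zero_sub, norm_neg, norm_mul, Complex.norm_real, Real.norm_eq_abs,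
            abs_of_nonneg (hP x).1]
          calc P x * ‖g x‖ ≤ 1 * 1 := mul_le_mul (hP x).2 (hg x) (norm_nonneg _) zero_le_one
            _ = 1 := one_mul 1
      · -- outside: indicator `0`, `P = 0`
        have hb : x ∉ B := fun h => hp (hBBp h)
        have hP0x : P x = 0 := by
          refine hP0 x ?_
          by_contra hall
          push Not at hall
          exact hp ((hmemBp x).2 hall)
        rw [if_neg hb, if_neg hp, if_neg hm, hP0x]
        simp
  calc ‖∑ x : ZMod N, ((if x ∈ B then g x else 0) - (P x : ℂ) * g x)‖
      ≤ ∑ x : ZMod N, ‖(if x ∈ B then g x else 0) - (P x : ℂ) * g x‖ := norm_sum_le _ _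
    _ ≤ ∑ x : ZMod N, ((if x ∈ Bp then (1 : ℝ) else 0) - (if x ∈ Bm then (1 : ℝ) else 0)) :=
        Finset.sum_le_sum fun x _ => hterm x
    _ = (#Bp : ℝ) - #Bm := by
        rw [Finset.sum_sub_distrib]
        simp only [Finset.sum_boole, Finset.filter_mem_eq_inter, Finset.univ_inter]
    _ ≤ 200 * (#S : ℝ) * ε * #B := hshell

/-- The product weight built from a cutoff takes values in `[0,1]`. [folklore] -/
theorem prod_cutoff_mem_Icc (S : Finset (ZMod N)) {κ : AddCircle (1 : ℝ) → ℝ}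
    (hκ : ∀ a, 0 ≤ κ a ∧ κ a ≤ 1) (x : ZMod N) :
    0 ≤ ∏ ξ ∈ S, κ (ZMod.toAddCircle (x * ξ)) ∧ ∏ ξ ∈ S, κ (ZMod.toAddCircle (x * ξ)) ≤ 1 :=
  ⟨Finset.prod_nonneg fun _ _ => (hκ _).1,
    Finset.prod_le_one (fun _ _ => (hκ _).1) fun _ _ => (hκ _).2⟩

/-- The product weight is `1` on the inner Bohr set. [cite: GreenTao2008U3Inverse, §12, proof of Thm. 68] -/
theorem prod_cutoff_eq_one (S : Finset (ZMod N)) {κ : AddCircle (1 : ℝ) → ℝ} {r₁ : ℝ}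
    (hκ1 : ∀ a, ‖a‖ ≤ r₁ → κ a = 1) (x : ZMod N)
    (hx : ∀ ξ ∈ S, ‖ZMod.toAddCircle (x * ξ)‖ < r₁) :
    ∏ ξ ∈ S, κ (ZMod.toAddCircle (x * ξ)) = 1 :=
  Finset.prod_eq_one fun ξ hξ => hκ1 _ (hx ξ hξ).le

/-- The product weight is `0` outside the outer Bohr set. [cite: GreenTao2008U3Inverse, §12, proof of Thm. 68] -/
theorem prod_cutoff_eq_zero (S : Finset (ZMod N)) {κ : AddCircle (1 : ℝ) → ℝ} {r₂ : ℝ}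
    (hκ0 : ∀ a, r₂ ≤ ‖a‖ → κ a = 0) (x : ZMod N)
    (hx : ∃ ξ ∈ S, r₂ ≤ ‖ZMod.toAddCircle (x * ξ)‖) :
    ∏ ξ ∈ S, κ (ZMod.toAddCircle (x * ξ)) = 0 := by
  obtain ⟨ξ, hξ, h⟩ := hx
  exact Finset.prod_eq_zero hξ (hκ0 _ h)

end Summit.Parity.GeneralizedHardyLittlewood.GreenTaoLevelTwoGITwoCyclicInverse
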